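import Literature.Barriers.NavierStokesRegularity.AveragedTypeIBlowup
import Summits.NavierStokesRegularity.NavierStokesRegularity.Theorems.PerpetualPumpAveragedTypeIBlowup

/-!
# Discharge of the barrier-catalogue fact `Literature.Barriers.NavierStokesRegularity.AveragedTypeIBlowup`

The catalogue entry `AveragedTypeIBlowup` (D-0021; Type-I / autonomous sharpening of Tao 2016,
Thm. 1.5: a symmetric cancelling averaged Navier–Stokes equation with an `H¹⁰_df`-mild Type-I-rate
blow-up from Schwartz data) is, by construction of that file, VERBATIM the route statement
`Theses.PerpetualPump.AveragedTypeIBlowup` (item stmt-NavierStokesRegularity-1835), which is proved in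
the tree by `PerpetualPumpAveragedTypeIBlowup.AveragedTypeIBlowup_of` (axioms `propext`,
`Classical.choice`, `Quot.sound`).  Literature may not import Summits (CONVENTIONS §2), so the
one-line identification lives here, Summits-side; it turns the catalogue's named fact into a theorem.
[cite: Tao2016AveragedNS, §1.1 Thm. 1.5 (p. 7) and footnote p. 8]
-/

namespace Summit.NavierStokesRegularity.NavierStokesRegularity.Theorems

-- the summit and its single problem share the name `NavierStokesRegularity` (D-0017 nested layout)
set_option linter.dupNamespace false

/-- **Discharge of `Literature.Barriers.NavierStokesRegularity.AveragedTypeIBlowup`**: the barrier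
statement is definitionally the PerpetualPump crux #3 `Theses.PerpetualPump.AveragedTypeIBlowup`,
proved in the tree as `PerpetualPumpAveragedTypeIBlowup.AveragedTypeIBlowup_of` (seeded graded Toda
local cascade at the Type-I pace, transferred to an averaging datum by Tao's Thm. 3.2).
[cite: Tao2016AveragedNS, §1.1 Thm. 1.5 (p. 7) and footnote p. 8; §3 Thm. 3.2] -/
theorem AveragedTypeIBlowup_holds : Literature.Barriers.NavierStokesRegularity.AveragedTypeIBlowup :=
  PerpetualPumpAveragedTypeIBlowup.AveragedTypeIBlowup_of

end Summit.NavierStokesRegularity.NavierStokesRegularity.Theorems
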